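/-
Copyright: statement-level skeleton of a published paper (lit-balaban cell, Phase-2 proof seat p32 gen 48). No claims beyond
what the kernel checks below.
-/
import Literature.MathematicalPhysics.QuantumFieldTheory.Balaban1983to89.B3Eq121WeightedClassValues
import Literature.MathematicalPhysics.QuantumFieldTheory.Balaban1983to89.B3GraphClassCount

/-!
# B3 — T. Bałaban, *(Higgs)₂,₃ quantum fields in a finite volume. III. Renormalization*, CMP **88** (1983) 411–445
[Balaban1983Higgs3], p. 416 [PDF 6] (1.21), p. 417 [PDF 7] (the insertion of δm²), p. 420 [PDF 10] d_s(G), d_v(G):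
**THE ORDERS OF THE LETTER CLASSES OF (1.21)** — a CONCRETE grading of the isomorphism classes of letters by
(d_s, d_v, number of mass-counterterm vertices), under which every letter class has positive order and every order carries
finitely many letter classes; hence r15's resummed (1.21) for the class values (p37) and for the symmetry-weighted class
values (p32 gen 47) holds with NO hypothesis left

statement-level skeleton of published theorems with citation tags; proofs where landed; nothing here is a claim about
the Yang–Mills mass gap

HEAD VIEW
```
object        : print's two-point expansion (1.21) G^ε = Σ_n C₀^ε[X C₀^ε]ⁿ regrouped over isomorphism classes of graphs,
                as an identity of formal power series in the couplings — here graded by σ = Fin 3: (d_s = order in λ,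
                d_v = order in e, number of vertices (1.7) = number of δm²-insertions)
given         : p37's `B3OnePIChainClassValues.eq121_classValue` and p32's `B3Eq121WeightedClassValues.eq121_weightedClassValue`
                — (1.21) on the class index for ANY order function `deg` on the letter classes, under `hne : ∀ c, deg c ≠ 0`
                and `hfin : ∀ d, {c | deg c = d}.Finite`
environment   : p18's `B3Cor23Concrete.Graph`, p37's `TwoLegGraph`, p32's classes `LetterClass` / `UnglueableClass`, p33's
                `B3ClassOrders420.dsG` / `dvG` / `ordersCt`, p32's `B3GraphFiniteOrder` (finiteness at bounded vertex number;
                the vertex bound `nV_le_of_isConnected`) and `B3GraphClassCount` (orders are isomorphism invariants)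
action        : `letterDeg c := orderVec (rep c)` = (d_s, d_v, #(1.7)-vertices) of the chosen representative — a class function
                (`letterDeg_mkC`); `letterDeg_ne_zero` (= `hne`) and `finite_letterDeg_eq` (= `hfin`) PROVED; orders add along
                chains (`orderVec_chain`), so the order of a regrouped term is (d_s, d_v, #(1.7)) of the whole graph
                (`classOrder_mkC_eq_orderVec`)
not claimed   : print's two-letter grading (e, λ) AFTER the insertion δm² = Σ e^αλ^βδm²_{(α,β)} of p. 417 (that insertion is a
                ring morphism and transports `Eq121` — `eq121_map` — but the substitution morphism is not constructed here);
                no bare `−δm²` letter (not a graph on p18's carrier); no symmetry factor beyond FILE E's; nothing analytic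
```

PDF held: `paper:balaban1983-higgs-2-3-quantum-fields-finite-volume` (journal page = PDF page + 410); pp. 416, 417, 420 re-read
this session in the store's text layer (`lit read … --pages 5-10`).

CITATION HEADER (lean-in-tree rule).  lit-balaban TYPED SKELETON (HOME `run/shared/lean/pub/lit-balaban/`), PHASE 2, seat p32
gen 48 (unit `lit-balaban-p32`; TAKING #1, HOME/STATUS.md 2026-08-25T05:15Z; free-target protocol G.5-34(d); item (δ) of the
p32 gen-46/47 HANDOFF blocks, p37 gen-109 OPEN (i)), row **B3.Eq1.19-1.22** ((1.21)–(1.22) p. 416) of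
`HOME/lit-balaban-r15/ROWS-B3.md` (fold owner r15, referee ref-4; the row's head is `proved`; this file is an OPTIONAL located
member of its (1.21) cell, ZERO head weight — it discharges the two hypotheses that p37's `eq121_classValue` and p32's
`eq121_weightedClassValue` still carry).  CONSUMES BY NAME: p18's `B3Cor23Concrete.Graph` (p. 415), r15's `B3Prop1.VertexKind` /
`.ds` / `.dv` ((1.6)–(1.15), p. 420), p37's `B3OnePIChainGlue.TwoLegGraph` / `glue2` / `chain` and `B3OnePIGraphs.IsConnected`,
p33's `B3ClassOrders420.dsG` / `dvG` / `ordersCt` / `ordersCt_eq`, p32's `B3GraphFiniteOrder.{nV_le_of_isConnected,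
finite_image_twoLeg_nV_le, eq_legAt113, isSome_other_legAt113}`, `B3GraphClassCount.{dsG_eq_of_graphIso, dvG_eq_of_graphIso}`,
`B3OnePIChainUnglue.IsLetter`, `B3OnePIChainClasses.{mkC, rep, repIso, LetterClass, UnglueableClass, classEquiv, isLetter_rep,
mkC_eq_mkC_iff}`, `B3Eq121OnePIChains.{sigmaSeries, chainDeg, …}`, p37's `B3ChainRegroupingValues.{objValue, objOrder,
LetterDressing}` and `B3OnePIChainClassValues.{classRegrouping, eq121_classValue, val_eq_mkC_chain, …}`, p32's
`B3Eq121SymmetryWeights.{termWeight, letterWeight}` and `B3Eq121WeightedClassValues.{eq121_weightedClassValue, …}`, r15's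
`B3Sect1TwoPoint.Eq121` / `dysonTerm`.  Nothing re-declared; no declaration is added to another file's namespace.

THE PRINTED TEXT (verbatim).  p. 416 [PDF 6]: *"The function G^ε has a perturbative expansion of the following structure
G^ε = Σ_{n=0}^{∞} C^ε_0[(−δm² + Σ^ε + ∂^{ε*}Σ^ε_1 + Σ^{ε*}_1∂^ε + ∂^{ε*}Σ^ε_2∂^ε)C^ε_0]ⁿ, (1.21) where C^ε_0 = (−Δ^ε_0 + m²)^{−1} and
Σ^ε, Σ^ε_1, Σ^ε_2 are given by amputated, one-particle-irreducible graphs of the expansion of G^ε. Here we have a graphical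
description of the same type as in (1.17), but with some simplifications. We have η = ε (hence L^kε = 1) and the only vertices
are (1.6), (1.7) [with δm² instead of δm_i²(x)], (1.8), and (1.10) …"*.  p. 417 [PDF 7]: *"This equation can be solved recursively
if δm² and Σ^ε are expanded into power series in e, λ. … More exactly we write δm² = Σ_{2≦α+2β≦4} e^αλ^βδm²_{(α,β)} and we insert
this into Σ^ε. This gives us an expansion of Σ^ε in coupling constants"*.  p. 420 [PDF 10]: *"Let us denote by d_s(v) an order
of the coupling constant λ for the vertex v, and by d_v(v) an order of the coupling constant e. Finally let d_s(G) = Σ_{v∈G}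
d_s(v), d_v(G) = Σ_{v∈G} d_v(v)."*  p. 415 [PDF 5]: *"There is at least one internal line, and every internal line has a
vertex at each endpoint."*

KIND «(ours)» (G.5-54): bookkeeping.  Print sums (1.21) order by order in the couplings without stating that each order is a
finite sum of graphs; on p18's carrier the vertex (1.7) carries no explicit coupling (p33's `orders_v17_bare`: its coupling sits
in δm², which print inserts afterwards, p. 417), so the honest grading of the letters BEFORE that insertion has a third formal
letter counting the δm²-insertions.  With it, the two facts print uses implicitly — every letter has positive order, finitely many
letters per order — are theorems of the model (this file), and (1.21) on the isomorphism classes needs no hypothesis.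

WHAT IS PROVED (definitions with bodies (bookkeeping) + theorems; no `Prop` fact, no `sorry`; standard axioms).
* `§1` `n17 G` (number of vertices (1.7)), `ct17 G` (the counterterm-order assignment (1, 0) at the (1.7)-vertices, 0 elsewhere),
  `orderVec G : Fin 3 →₀ ℕ` (= (d_s(G), d_v(G), n17 G)); `total_ordersCt_ct17` (p33's total order with `ct17` = d_s + d_v + n17 =
  `degree_orderVec`); `orderVec_eq_of_graphIso` (a class invariant; FILE C); `orderVec_glue2` / **`orderVec_chain`** (orders ADD
  along the chains of (1.21) — print's Σ_{v∈G} over a disjoint union of vertex sets).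
* `§2` **`kind_legIn_ne_v113`** (a CONNECTED two-leg insertion has a vertex other than the operator vertex (1.13): the vertex of
  its in-leg — a (1.13)-vertex has one leg, which would be the external in-leg, leaving the vertex isolated, while a graph has a
  line); `one_le_nV`; **`nV_le_degree_orderVec`** (a connected insertion has at most (n̄ + 5)·|orderVec| vertices — gen-45
  `nV_le_of_isConnected` with `ct17`); **`orderVec_ne_zero`**; `orderVec_chain17` (gen-45's order-(0,0) witness, the bare
  (1.7)-chain on m + 2 vertices, has order vector (0, 0, m + 2): the third letter is exactly what it carries).
* `§3` **`letterDeg`** (the grading of the letter classes), `letterDeg_eq_orderVec_of_iso` / `letterDeg_mkC` (computed on any member),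
  **`letterDeg_ne_zero`** (p37's / FILE 1's hypothesis `hne`), `nV_rep_le`, `finite_letterDeg_degree_le`, **`finite_letterDeg_eq`**
  (the hypothesis `hfin`); `classOrder_none`, **`classOrder_some_eq_orderVec`** / `classOrder_mkC_eq_orderVec` (the order of a
  regrouped term of (1.21), summed letter by letter, IS (d_s, d_v, n17) of the whole graph).
* `§4` (1.21) WITH NO HYPOTHESIS LEFT, in `(Matrix IS IS ℝ)[[Fin 3]]`: **`eq121_classValue_letterDeg`** (p37's class values),
  **`eq121_weightedClassValue_letterDeg`** (the symmetry-weighted class values), `sigmaSeries_classValue_eq_tsum_dysonTerm_letterDeg` /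
  `sigmaSeries_weightedClassValue_eq_tsum_dysonTerm_letterDeg` (as the printed series `Σ'_n C₀[XC₀]ⁿ`),
  `coeff_classValue_eq_sum_dysonTerm_letterDeg` / `coeff_weightedClassValue_eq_sum_dysonTerm_letterDeg` (order by order, finite
  sums), `eq121_iff_eq_classValue_letterDeg` / `eq121_iff_eq_weightedClassValue_letterDeg` (uniqueness).
* `§5` `eq121_map`: r15's resummed form `Eq121 G C₀ X` is transported by every ring morphism (the shape of print's *"we insert
  this into Σ^ε"*, p. 417).
HONEST SCOPE.  (i) The grading is «(ours)»: (d_s, d_v) are print's p. 420 orders on p18's carrier; the third component counts the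
vertices (1.7), i.e. (1.21) is graded BEFORE print's insertion δm² = Σ_{2≦α+2β≦4} e^αλ^βδm²_{(α,β)} (p. 417); the two-letter
(e, λ)-grading after the insertion is NOT constructed (the coefficient ring `Matrix IS IS ℝ` is noncommutative, and Mathlib's
substitution of power series is stated for commutative coefficients; `eq121_map` records only that any such morphism transports
the identity).  (ii) The scope of p37's `B3OnePIChainClassValues` and of FILE E / gen 47 stands: no bare `−δm²` letter (a vertex
(1.7) alone is not a graph, p. 415), no sorting of the letters into `Σ^ε, ∂^{ε*}Σ^ε_1, Σ^{ε*}_1∂^ε, ∂^{ε*}Σ^ε_2∂^ε`, the dressing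
of the letters a parameter, the weights FILE E's vertex-relabelling frequencies; nothing analytic.  (iii) p18's carrier admits all
the vertices (1.6)–(1.15) of the η-lattice catalogue, more than print's list for G^ε on p. 416 ((1.6), (1.7), (1.8), (1.10)); the
two discharged hypotheses restrict to any subfamily of letter classes (a subtype inherits `letterDeg_ne_zero` and, by
`Set.Finite.preimage`, `finite_letterDeg_eq`), so FILE 1's `eq121_greenSeries` applies to print's subfamily as well; the class-value
theorems of `§4` are stated for the whole family, as p37's and gen 47's are.
Unit `lit-balaban-p32` gen 48 (literature-prover-lit-balaban-p32-g48-0), HOME `run/shared/lean/pub/lit-balaban/`, 2026-08-25.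
-/

open Finset
open scoped BigOperators

namespace Literature.MathematicalPhysics.QuantumFieldTheory.Balaban1983to89.B3Eq121LetterClassOrders

open B3Sect1TwoPoint (dysonTerm Eq121)
open B3Prop1 B3Cor23Concrete B3OnePIGraphs B3GraphIso B3OnePIChainGlue B3OnePIChainPieceGraphs B3OnePIChainUnglue
  B3OnePIChainClasses B3ClassOrders420 B3GraphFiniteOrder B3GraphClassCount B3Eq121OnePIChains B3ChainRegroupingValues B3OnePIChainClassValues
  B3Eq121SymmetryWeights B3Eq121WeightedClassValues

variable {nbar : ℕ}

/-! ## §1 The three orders of a graph: d_s(G), d_v(G) and the number of mass-counterterm vertices (1.7) -/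

section Orders

variable (G : Graph nbar)

/-- The number of mass-renormalization vertices (1.7) of `G` — the number of δm²-insertions it carries (p. 416: in the expansion
of G^ε the vertex (1.7) appears *"with δm² instead of δm_i²(x)"*) («(ours)», bookkeeping). [cite: Balaban1983Higgs3, (1.7) p.413, (1.21) p.416] -/
def n17 : ℕ := (univ.filter fun i : Fin G.nV => G.kind i = .v17).card

/-- The counterterm-order assignment counting ONE unit at every vertex (1.7) and nothing elsewhere (p33's `ordersCt` bookkeeping
with the δm²-insertion as its own letter of order one) («(ours)», bookkeeping). [cite: Balaban1983Higgs3, p.417, p.420] -/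
def ct17 : Fin G.nV → ℕ × ℕ := fun i => if G.kind i = .v17 then (1, 0) else (0, 0)

/-- kernel: `ct17` is positive at every vertex (1.7) (the proviso of gen-45 `nV_le_of_isConnected`). [cite: Balaban1983Higgs3, p.417] -/
theorem ct17_pos (i : Fin G.nV) (hi : G.kind i = .v17) : 1 ≤ (ct17 G i).1 + (ct17 G i).2 := by
  simp [ct17, hi]

/-- kernel: the first components of `ct17` count the vertices (1.7). [cite: Balaban1983Higgs3, (1.7) p.413] -/
theorem sum_ct17_fst : ∑ i, (ct17 G i).1 = n17 G := by
  unfold ct17 n17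
  rw [Finset.card_filter]
  refine Finset.sum_congr rfl fun i _ => ?_
  split_ifs <;> rfl

/-- kernel: the second components of `ct17` vanish. [cite: Balaban1983Higgs3, (1.7) p.413] -/
theorem sum_ct17_snd : ∑ i, (ct17 G i).2 = 0 := by
  refine Finset.sum_eq_zero fun i _ => ?_
  unfold ct17
  split_ifs <;> rfl

/-- kernel: p33's orders with the counterterm orders `ct17` are (d_s + n17, d_v). [cite: Balaban1983Higgs3, p.420] -/
theorem ordersCt_ct17 : ordersCt G (ct17 G) = (dsG G + n17 G, dvG G) := by
  rw [ordersCt_eq, sum_ct17_fst, sum_ct17_snd, add_zero]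

/-- kernel: the TOTAL order with `ct17` is d_s(G) + d_v(G) + n17(G). [cite: Balaban1983Higgs3, p.420] -/
theorem total_ordersCt_ct17 : (ordersCt G (ct17 G)).1 + (ordersCt G (ct17 G)).2 = dsG G + dvG G + n17 G := by
  rw [ordersCt_ct17]
  dsimp only
  omega

/-- **The order vector of a graph**: `(d_s(G), d_v(G), n17 G) ∈ Fin 3 →₀ ℕ` — the exponent of `λ^{d_s} e^{d_v} (δm²)^{n17}`, the
monomial the graph carries in (1.21) BEFORE the insertion of δm² = Σ e^αλ^βδm²_{(α,β)} (p. 417) («(ours)», bookkeeping).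
[cite: Balaban1983Higgs3, p.420, (1.21) p.416, p.417] -/
noncomputable def orderVec : Fin 3 →₀ ℕ :=
  Finsupp.single 0 (dsG G) + Finsupp.single 1 (dvG G) + Finsupp.single 2 (n17 G)

/-- kernel: component 0 = d_s(G). [cite: Balaban1983Higgs3, p.420] -/
@[simp] theorem orderVec_apply_zero : orderVec G 0 = dsG G := by
  simp [orderVec]

/-- kernel: component 1 = d_v(G). [cite: Balaban1983Higgs3, p.420] -/
@[simp] theorem orderVec_apply_one : orderVec G 1 = dvG G := by
  simp [orderVec]

/-- kernel: component 2 = the number of vertices (1.7). [cite: Balaban1983Higgs3, (1.7) p.413] -/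
@[simp] theorem orderVec_apply_two : orderVec G 2 = n17 G := by
  simp [orderVec]

/-- kernel: the total degree of the order vector is d_s + d_v + n17. [cite: Balaban1983Higgs3, p.420] -/
theorem degree_orderVec : (orderVec G).degree = dsG G + dvG G + n17 G := by
  simp only [orderVec, map_add, Finsupp.degree_single]

/-- kernel: the total degree of the order vector is p33's total order with `ct17`. [cite: Balaban1983Higgs3, p.420] -/
theorem degree_orderVec_eq_total_ordersCt : (orderVec G).degree = (ordersCt G (ct17 G)).1 + (ordersCt G (ct17 G)).2 := by
  rw [degree_orderVec, total_ordersCt_ct17]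

end Orders

/-- kernel: the number of vertices (1.7) is an isomorphism invariant (the vertex bijection preserves kinds).
[cite: Balaban1983Higgs3, p.415, (1.7) p.413] -/
theorem n17_eq_of_graphIso {G H : Graph nbar} (e : GraphIso G H) : n17 H = n17 G := by
  unfold n17
  rw [Finset.card_filter, Finset.card_filter]
  exact Fintype.sum_equiv e.toEquiv.symm _ _ fun w => by rw [e.kind_eq_symm w]

/-- **THE ORDER VECTOR IS A CLASS FUNCTION**: isomorphic graphs have the same (d_s, d_v, n17) (FILE C's `dsG_eq_of_graphIso` /
`dvG_eq_of_graphIso`, and `n17_eq_of_graphIso`). [cite: Balaban1983Higgs3, p.420, p.415] -/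
theorem orderVec_eq_of_graphIso {G H : Graph nbar} (e : GraphIso G H) : orderVec H = orderVec G := by
  unfold orderVec
  rw [dsG_eq_of_graphIso e, dvG_eq_of_graphIso e, n17_eq_of_graphIso e]

/-- kernel: a sum over the vertices of a glued graph (kinds `Fin.append k₁ k₂`) splits over the two pieces — print's Σ_{v∈G} over
a disjoint union of vertex sets. [cite: Balaban1983Higgs3, p.420] -/
theorem sum_fin_append {M : Type*} [AddCommMonoid M] {m n : ℕ} (k₁ : Fin m → VertexKind) (k₂ : Fin n → VertexKind)
    (f : VertexKind → M) : ∑ i, f (Fin.append k₁ k₂ i) = ∑ i, f (k₁ i) + ∑ j, f (k₂ j) := by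
  rw [Fin.sum_univ_add]
  simp only [Fin.append_left, Fin.append_right]

/-- kernel: d_s adds under gluing two insertions along a new line. [cite: Balaban1983Higgs3, p.420, (1.21) p.416] -/
theorem dsG_glue2 (T₁ T₂ : TwoLegGraph nbar) : dsG (glue2 T₁ T₂).G = dsG T₁.G + dsG T₂.G :=
  sum_fin_append T₁.G.kind T₂.G.kind VertexKind.ds

/-- kernel: d_v adds under gluing. [cite: Balaban1983Higgs3, p.420, (1.21) p.416] -/
theorem dvG_glue2 (T₁ T₂ : TwoLegGraph nbar) : dvG (glue2 T₁ T₂).G = dvG T₁.G + dvG T₂.G :=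
  sum_fin_append T₁.G.kind T₂.G.kind VertexKind.dv

/-- kernel: the number of vertices (1.7) adds under gluing. [cite: Balaban1983Higgs3, (1.7) p.413, (1.21) p.416] -/
theorem n17_glue2 (T₁ T₂ : TwoLegGraph nbar) : n17 (glue2 T₁ T₂).G = n17 T₁.G + n17 T₂.G := by
  unfold n17
  rw [Finset.card_filter, Finset.card_filter, Finset.card_filter]
  exact sum_fin_append T₁.G.kind T₂.G.kind fun v => if v = .v17 then 1 else 0

/-- **ORDERS ADD UNDER GLUING**: `orderVec (glue2 T₁ T₂) = orderVec T₁ + orderVec T₂`. [cite: Balaban1983Higgs3, p.420, (1.21) p.416] -/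
theorem orderVec_glue2 (T₁ T₂ : TwoLegGraph nbar) : orderVec (glue2 T₁ T₂).G = orderVec T₁.G + orderVec T₂.G := by
  unfold orderVec
  rw [dsG_glue2, dvG_glue2, n17_glue2, Finsupp.single_add, Finsupp.single_add, Finsupp.single_add]
  abel

/-- **ORDERS ADD ALONG THE CHAINS OF (1.21)**: the order vector of `chain P [l₁, …, l_m]` is `orderVec P + Σ_k orderVec l_k` —
the order of a term `C₀K₁C₀⋯K_mC₀` is the sum of the orders of its 1PI pieces. [cite: Balaban1983Higgs3, (1.21) p.416, p.420] -/
theorem orderVec_chain (P : TwoLegGraph nbar) (l : List (TwoLegGraph nbar)) :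
    orderVec (chain P l).G = orderVec P.G + (l.map fun T => orderVec T.G).sum := by
  induction l generalizing P with
  | nil => simp
  | cons T l ih => rw [chain_cons, orderVec_glue2, ih, List.map_cons, List.sum_cons]

/-! ## §2 A connected two-leg insertion has a vertex carrying a coupling; its size is bounded by its order -/

/-- kernel: a graph of the model has a vertex (it has a line, p. 415). [cite: Balaban1983Higgs3, p.415] -/
theorem one_le_nV (G : Graph nbar) : 1 ≤ G.nV := by
  obtain ⟨x, -⟩ := G.exists_line
  exact x.1.pos

/-- **THE VERTEX OF THE IN-LEG OF A CONNECTED INSERTION IS NOT AN OPERATOR VERTEX (1.13)**: a vertex (1.13) has a single leg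
(r15's catalogue); were it the vertex of the (external) in-leg, no line could reach it — but the graph has a line (p. 415) and is
connected. [cite: Balaban1983Higgs3, (1.13) p.414, p.415, (1.21) p.416] -/
theorem kind_legIn_ne_v113 (T : TwoLegGraph nbar) (hT : IsConnected T.G) : T.G.kind T.legIn.1 ≠ .v113 := by
  intro h
  have hleg : T.legIn = legAt113 T.G T.legIn.1 h := eq_legAt113 T.G h rfl
  by_cases hV : ∃ j : Fin T.G.nV, j ≠ T.legIn.1
  · obtain ⟨j, hj⟩ := hV
    have hs := isSome_other_legAt113 T.G hT (Ne.symm hj) h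
    rw [← hleg, T.in_ext] at hs
    exact Bool.false_ne_true hs
  · push Not at hV
    obtain ⟨x, hx⟩ := T.G.exists_line
    have hxl : x = T.legIn := (eq_legAt113 T.G h (hV x.1)).trans hleg.symm
    rw [hxl, T.in_ext] at hx
    exact Bool.false_ne_true hx

/-- kernel: hence a connected insertion is not made of (1.13)-vertices only (the proviso of gen-45 `nV_le_of_isConnected`).
[cite: Balaban1983Higgs3, (1.13) p.414, (1.21) p.416] -/
theorem exists_kind_ne_v113 (T : TwoLegGraph nbar) (hT : IsConnected T.G) : ∃ j, T.G.kind j ≠ .v113 :=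
  ⟨T.legIn.1, kind_legIn_ne_v113 T hT⟩

/-- **SIZE BOUND**: a connected two-leg insertion has at most `(n̄ + 5)·(d_s + d_v + n17)` vertices (gen-45 `nV_le_of_isConnected`
with the δm²-insertions counted by `ct17`). [cite: Balaban1983Higgs3, p.420, (1.21) p.416] -/
theorem nV_le_degree_orderVec (T : TwoLegGraph nbar) (hT : IsConnected T.G) :
    T.G.nV ≤ (nbar + 5) * (orderVec T.G).degree := by
  rw [degree_orderVec_eq_total_ordersCt]
  exact nV_le_of_isConnected T.G hT (exists_kind_ne_v113 T hT) (ct17 T.G) (ct17_pos T.G)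

/-- **A CONNECTED INSERTION HAS POSITIVE ORDER** in (λ, e, δm²). [cite: Balaban1983Higgs3, p.420, (1.21) p.416] -/
theorem orderVec_ne_zero (T : TwoLegGraph nbar) (hT : IsConnected T.G) : orderVec T.G ≠ 0 := by
  intro h
  have h1 := nV_le_degree_orderVec T hT
  have h2 := one_le_nV T.G
  rw [h, map_zero, mul_zero] at h1
  omega

/-- kernel: **the third letter is what the bare (1.7)-chains carry** — gen-45's witness `chain17 n̄ m` (m + 2 vertices (1.7) in
a row; orders (d_s, d_v) = (0, 0), whence `not_finite_connected_orders_zero`) has order vector (0, 0, m + 2).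
[cite: Balaban1983Higgs3, (1.7) p.413, p.417, p.420] -/
theorem orderVec_chain17 (nbar m : ℕ) : orderVec (chain17 nbar m) = Finsupp.single 2 (m + 2) := by
  have h0 := chain17_orders nbar m
  simp only [orders, Prod.mk.injEq] at h0
  have h2 : n17 (chain17 nbar m) = m + 2 := by
    unfold n17
    rw [Finset.filter_true_of_mem fun i _ => (chain17_nV_kind nbar m).2 i, card_univ, Fintype.card_fin]
    rfl
  rw [orderVec, h0.1, h0.2, h2]
  simp

/-! ## §3 The grading of the letter classes; `hne` and `hfin` -/

/-- **THE ORDER OF A LETTER CLASS of (1.21)**: (d_s, d_v, n17) of its chosen representative (a class function, `letterDeg_mkC`)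
(«(ours)»: the concrete `deg` of FILE 1 / p37's `eq121_classValue` on p32's class index). [cite: Balaban1983Higgs3, (1.21) p.416, p.420] -/
noncomputable def letterDeg (c : LetterClass nbar) : Fin 3 →₀ ℕ :=
  orderVec (rep c.1).G

/-- kernel: the order of a letter class is computed on ANY member. [cite: Balaban1983Higgs3, (1.21) p.416, p.420] -/
theorem letterDeg_eq_orderVec_of_iso {c : LetterClass nbar} {T : TwoLegGraph nbar} (e : TwoLegGraphIso (rep c.1) T) :
    letterDeg c = orderVec T.G :=
  (orderVec_eq_of_graphIso e.toGraphIso).symm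

/-- kernel: the order of the class of a letter `T` is (d_s, d_v, n17)(T). [cite: Balaban1983Higgs3, (1.21) p.416, p.420] -/
theorem letterDeg_mkC (T : TwoLegGraph nbar) (hT : IsLetter T) :
    letterDeg ⟨mkC T, isLetterC_mkC.mpr hT⟩ = orderVec T.G :=
  letterDeg_eq_orderVec_of_iso (repIso T)

/-- **EVERY LETTER CLASS HAS POSITIVE ORDER** — the hypothesis `hne : ∀ c, deg c ≠ 0` of FILE 1 / p37's `eq121_classValue` /
p32's `eq121_weightedClassValue`, DISCHARGED for `letterDeg` (a letter is connected). [cite: Balaban1983Higgs3, (1.21) p.416, p.420] -/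
theorem letterDeg_ne_zero (c : LetterClass nbar) : letterDeg c ≠ 0 :=
  orderVec_ne_zero (rep c.1) (isLetter_rep c.2).1

/-- kernel: the representative of a letter class of order `d` has at most `(n̄ + 5)·|d|` vertices.
[cite: Balaban1983Higgs3, (1.21) p.416, p.420] -/
theorem nV_rep_le (c : LetterClass nbar) : (rep c.1).G.nV ≤ (nbar + 5) * (letterDeg c).degree :=
  nV_le_degree_orderVec (rep c.1) (isLetter_rep c.2).1

/-- kernel: finitely many letter classes of total order `≤ N` (gen-45 `finite_image_twoLeg_nV_le`: finitely many classes are met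
by the insertions with boundedly many vertices). [cite: Balaban1983Higgs3, (1.21) p.416, p.420] -/
theorem finite_letterDeg_degree_le (N : ℕ) : {c : LetterClass nbar | (letterDeg c).degree ≤ N}.Finite := by
  have hfin := finite_image_twoLeg_nV_le (nbar := nbar) mkC ((nbar + 5) * N)
  refine (hfin.preimage Subtype.val_injective.injOn).subset fun c hc => ?_
  exact ⟨rep c.1, (nV_rep_le c).trans (Nat.mul_le_mul_left _ hc), mkC_rep c.1⟩

/-- **FINITELY MANY LETTER CLASSES AT EACH ORDER** — the hypothesis `hfin : ∀ d, {c | deg c = d}.Finite` of FILE 1 / p37 / p32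
gen 47, DISCHARGED for `letterDeg`. [cite: Balaban1983Higgs3, (1.21) p.416, p.420] -/
theorem finite_letterDeg_eq (d : Fin 3 →₀ ℕ) : {c : LetterClass nbar | letterDeg c = d}.Finite :=
  (finite_letterDeg_degree_le d.degree).subset fun c hc => by
    simp only [Set.mem_setOf_eq] at hc ⊢
    rw [hc]

/-- kernel: the bare line (the `n = 0` term of (1.21)) has order 0. [cite: Balaban1983Higgs3, (1.21) p.416] -/
theorem classOrder_none : objOrder (classRegrouping nbar) letterDeg none = 0 :=
  (classOrder_eq_chainDeg letterDeg none).trans (by rw [classEquivList_none, chainDeg_nil])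

/-- **THE ORDER OF A REGROUPED TERM OF (1.21), summed letter class by letter class along p32's `classEquivList`, IS
(d_s, d_v, n17) OF THE WHOLE GRAPH** (orders add along chains, `orderVec_chain`; the class of an unglueable insertion is the class
of the chain of the representatives of its letter classes, p37's `val_eq_mkC_chain`). [cite: Balaban1983Higgs3, (1.21) p.416, p.420] -/
theorem classOrder_some_eq_orderVec (y : UnglueableClass nbar) :
    objOrder (classRegrouping nbar) letterDeg (some y) = orderVec (rep y.1).G := by
  obtain ⟨e⟩ := mkC_eq_mkC_iff.mp ((mkC_rep y.1).trans (val_eq_mkC_chain y))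
  refine (classOrder_eq_chainDeg letterDeg (some y)).trans ?_
  rw [classEquivList_some, chainDeg_cons, ← orderVec_eq_of_graphIso e.toGraphIso, orderVec_chain, classEquiv_apply,
    List.map_map]
  rfl

/-- kernel: for an unglueable insertion `T`, the order of the term of (1.21) indexed by its class is (d_s, d_v, n17)(T).
[cite: Balaban1983Higgs3, (1.21) p.416, p.420] -/
theorem classOrder_mkC_eq_orderVec (T : TwoLegGraph nbar) (hU : Unglueable T) :
    objOrder (classRegrouping nbar) letterDeg (some ⟨mkC T, unglueableC_mkC.mpr hU⟩) = orderVec T.G := by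
  rw [classOrder_some_eq_orderVec]
  exact (orderVec_eq_of_graphIso (repIso T).toGraphIso).symm

/-! ## §4 (1.21) on the isomorphism classes with NO hypothesis left -/

noncomputable section

variable {SF VF OF IS IV IO : Type*} [Fintype IS] [Fintype IV] [Fintype IO] [DecidableEq IS]
  (bS : IS → SF) (bV : IV → VF) (bO : IO → OF) (C : IS → IS → ℝ)
  (Dc : LetterDressing (classRegrouping nbar) SF VF OF IS IV IO)

/-- **(1.21) FOR THE CLASS VALUES, UNCONDITIONALLY**: r15's resummed `Eq121 G (C C₀) X` (`G = C₀ + G·X·C₀`) HOLDS in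
`(Matrix IS IS ℝ)[[Fin 3]]` for `G` = the series of p37's class values (bare line ⊕ unglueable classes, valued `C₀·K(rep)·C₀`) and
`X` = the series of the letter classes' amputated kernels, both graded by (d_s, d_v, n17) — p37's `eq121_classValue` with `hne`,
`hfin` discharged by `§3`. [cite: Balaban1983Higgs3, (1.21) p.416] [cite: Balaban1983Higgs3, p.420] -/
theorem eq121_classValue_letterDeg :
    Eq121 (sigmaSeries (objValue (classRegrouping nbar) bS bV bO C Dc) (objOrder (classRegrouping nbar) letterDeg))
      (MvPowerSeries.C (Matrix.of C)) (sigmaSeries (fun c => (Dc c).kernel bS bV bO) letterDeg) :=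
  eq121_classValue bS bV bO C Dc letterDeg letterDeg_ne_zero finite_letterDeg_eq

/-- **(1.21) WITH THE COMBINATORIC FACTORS WRITTEN, UNCONDITIONALLY**: `Eq121 G (C C₀) X` HOLDS in `(Matrix IS IS ℝ)[[Fin 3]]` for
`G = Σ_g (1/|Aut g|)·value g·e^{order g}` and `X = Σ_c (1/|Aut c|)·K(rep c)·e^{letterDeg c}` — p32 gen 47's
`eq121_weightedClassValue` with `hne`, `hfin` discharged. [cite: Balaban1983Higgs3, (1.21)–(1.22) p.416] [cite: Balaban1983Higgs3, p.420] -/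
theorem eq121_weightedClassValue_letterDeg :
    Eq121 (sigmaSeries (fun g => termWeight g • objValue (classRegrouping nbar) bS bV bO C Dc g)
        (objOrder (classRegrouping nbar) letterDeg))
      (MvPowerSeries.C (Matrix.of C)) (sigmaSeries (fun c => letterWeight c • (Dc c).kernel bS bV bO) letterDeg) :=
  eq121_weightedClassValue bS bV bO C Dc letterDeg letterDeg_ne_zero finite_letterDeg_eq

open MvPowerSeries.WithPiTopology in
/-- **AS THE PRINTED SERIES, unconditionally**: the class-value series `= Σ'_n C₀[XC₀]ⁿ` in `(Matrix IS IS ℝ)[[Fin 3]]` (product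
topology on coefficients). [cite: Balaban1983Higgs3, (1.21) p.416] -/
theorem sigmaSeries_classValue_eq_tsum_dysonTerm_letterDeg :
    sigmaSeries (objValue (classRegrouping nbar) bS bV bO C Dc) (objOrder (classRegrouping nbar) letterDeg) =
      ∑' n, dysonTerm (MvPowerSeries.C (Matrix.of C)) (sigmaSeries (fun c => (Dc c).kernel bS bV bO) letterDeg) n :=
  sigmaSeries_classValue_eq_tsum_dysonTerm bS bV bO C Dc letterDeg letterDeg_ne_zero finite_letterDeg_eq

open MvPowerSeries.WithPiTopology in
/-- **AS THE PRINTED SERIES, weighted, unconditionally**: `Σ_g (1/|Aut g|)·value g·e^{order g} = Σ'_n C₀[XC₀]ⁿ` with the weighted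
`X`. [cite: Balaban1983Higgs3, (1.21)–(1.22) p.416] -/
theorem sigmaSeries_weightedClassValue_eq_tsum_dysonTerm_letterDeg :
    sigmaSeries (fun g => termWeight g • objValue (classRegrouping nbar) bS bV bO C Dc g)
        (objOrder (classRegrouping nbar) letterDeg) =
      ∑' n, dysonTerm (MvPowerSeries.C (Matrix.of C))
        (sigmaSeries (fun c => letterWeight c • (Dc c).kernel bS bV bO) letterDeg) n :=
  sigmaSeries_weightedClassValue_eq_tsum_dysonTerm bS bV bO C Dc letterDeg letterDeg_ne_zero finite_letterDeg_eq

/-- **ORDER BY ORDER, unconditionally**: at every order `d ∈ Fin 3 →₀ ℕ` the coefficient of the class-value series is the finite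
sum `Σ_{n ≤ |d|} coeff_d (C₀[XC₀]ⁿ)`. [cite: Balaban1983Higgs3, (1.21) p.416] -/
theorem coeff_classValue_eq_sum_dysonTerm_letterDeg (d : Fin 3 →₀ ℕ) :
    MvPowerSeries.coeff d (sigmaSeries (objValue (classRegrouping nbar) bS bV bO C Dc)
        (objOrder (classRegrouping nbar) letterDeg)) =
      ∑ n ∈ Finset.range (d.degree + 1), MvPowerSeries.coeff d
        (dysonTerm (MvPowerSeries.C (Matrix.of C)) (sigmaSeries (fun c => (Dc c).kernel bS bV bO) letterDeg) n) :=
  coeff_classValue_eq_sum_dysonTerm bS bV bO C Dc letterDeg letterDeg_ne_zero finite_letterDeg_eq d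

/-- **ORDER BY ORDER, weighted, unconditionally**. [cite: Balaban1983Higgs3, (1.21)–(1.22) p.416] -/
theorem coeff_weightedClassValue_eq_sum_dysonTerm_letterDeg (d : Fin 3 →₀ ℕ) :
    MvPowerSeries.coeff d (sigmaSeries (fun g => termWeight g • objValue (classRegrouping nbar) bS bV bO C Dc g)
        (objOrder (classRegrouping nbar) letterDeg)) =
      ∑ n ∈ Finset.range (d.degree + 1), MvPowerSeries.coeff d
        (dysonTerm (MvPowerSeries.C (Matrix.of C))
          (sigmaSeries (fun c => letterWeight c • (Dc c).kernel bS bV bO) letterDeg) n) :=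
  coeff_weightedClassValue_eq_sum_dysonTerm bS bV bO C Dc letterDeg letterDeg_ne_zero finite_letterDeg_eq d

/-- **UNIQUENESS, unconditionally**: a formal series `G` satisfies `Eq121 G (C C₀) X` with `X` the letter-class series IFF `G` is
the class-value series. [cite: Balaban1983Higgs3, (1.21) p.416] -/
theorem eq121_iff_eq_classValue_letterDeg {G : MvPowerSeries (Fin 3) (Matrix IS IS ℝ)} :
    Eq121 G (MvPowerSeries.C (Matrix.of C)) (sigmaSeries (fun c => (Dc c).kernel bS bV bO) letterDeg) ↔
      G = sigmaSeries (objValue (classRegrouping nbar) bS bV bO C Dc) (objOrder (classRegrouping nbar) letterDeg) :=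
  eq121_iff_eq_classValue bS bV bO C Dc letterDeg letterDeg_ne_zero finite_letterDeg_eq

/-- **UNIQUENESS, weighted, unconditionally**. [cite: Balaban1983Higgs3, (1.21)–(1.22) p.416] -/
theorem eq121_iff_eq_weightedClassValue_letterDeg {G : MvPowerSeries (Fin 3) (Matrix IS IS ℝ)} :
    Eq121 G (MvPowerSeries.C (Matrix.of C)) (sigmaSeries (fun c => letterWeight c • (Dc c).kernel bS bV bO) letterDeg) ↔
      G = sigmaSeries (fun g => termWeight g • objValue (classRegrouping nbar) bS bV bO C Dc g)
        (objOrder (classRegrouping nbar) letterDeg) :=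
  eq121_iff_eq_weightedClassValue bS bV bO C Dc letterDeg letterDeg_ne_zero finite_letterDeg_eq

end

/-! ## §5 The resummed (1.21) is transported by ring morphisms (the shape of the insertion of δm², p. 417) -/

/-- **`Eq121` IS TRANSPORTED BY EVERY RING MORPHISM**: if `G = C₀ + G·X·C₀` in `R` and `φ : R →+* S`, then
`φ G = φ C₀ + φ G·φ X·φ C₀` in `S` — in particular by any substitution morphism realising print's *"we write
δm² = Σ_{2≦α+2β≦4} e^αλ^βδm²_{(α,β)} and we insert this into Σ^ε"* (p. 417; the morphism itself is not constructed here).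
[cite: Balaban1983Higgs3, (1.21) p.416] [cite: Balaban1983Higgs3, p.417] -/
theorem eq121_map {R S : Type*} [Ring R] [Ring S] (φ : R →+* S) {G C0 X : R} (h : Eq121 G C0 X) :
    Eq121 (φ G) (φ C0) (φ X) := by
  unfold Eq121 at h ⊢
  rw [← map_mul, ← map_mul, ← map_add]
  exact congrArg φ h

end Literature.MathematicalPhysics.QuantumFieldTheory.Balaban1983to89.B3Eq121LetterClassOrders
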